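import Summits.BirchSwinnertonDyer.Rank1Residual.Additive.LegendreTwistRelationOfCharTwist
import HarnessLib

/-!
# Class N10, defect 2: the LEGENDRE TWIST RELATION PROVED on the ODD branch — for rational newforms
# `f = g ⊗ (·/p)` in `q`-expansion with `p ≡ 3 (mod 4)`, the PLUS symbols of `f` are a rational
# multiple of the `(·/p)`-twisted MINUS symbols of `g` (`LegendreTwistMinusRel`)
# (cell `b2b-bsdres`, lane CLASS-CLOSURE, seat cc-typer-2 GEN 4; odd twin of GEN 3's
# `LegendreTwistRelationOfCharTwist.lean`; discharges the comparison-statement binder of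
# `TameBranchOfSemistableTwistJoin.lean` §6 on its natural locus)

HONEST FRAMING (cell `b2b-bsdres`, run/shared/lean/b2b/bsd-rank1-residual/, verbatim in every
file): the goal of the cell is to DELETE the COMBINATION-SHAPED residual classes of the
Birch–Swinnerton-Dyer formula for ALL analytic-rank `≤ 1` elliptic curves over `ℚ` — "full BSD
formula for every rank `≤ 1` curve in class `C`" assembled STRICTLY from published theorems — so
that the rank-`≤ 1` remainder becomes exactly the CONSTRUCTION-SHAPED classes, which are TYPED
(missing-input `Prop`s), NOT attempted. This is not "finishing BSD". Lane CLASS-CLOSURE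
(coordinator ruling 2026-08-21T04:07Z): research routes, no claim beyond the stated classes;
census output = EVIDENCE / conjecture items with held-out validation, NEVER a Literature fact;
the class N10 stays CONSTRUCTION-shaped (RESIDUAL-MAP §I); NOTHING is booked. THEOREMS ONLY; no
definition, no named fact, no conjecture node; labels / RESIDUAL-MAP marks UNCHANGED.

## What and why

`TameBranchOfSemistableTwistJoin.lean` §6 delivers the E-normalised tame branch of an additive curve
of defect `2` at a prime `p ≡ 3 (mod 4)` from the MINUS Mazur–Tate–Teitelbaum symbols of its twist,
MODULO (a) the comparison statement `LegendreTwistMinusRel p f g c : ∀ s, [s]⁺_f =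
c·∑_{u mod p}(u/p)[s + u/p]⁻_g` and (b) a common denominator of the `[·]⁻_g` (`hden`). (b) is now
the tree's `exists_forall_ratMinusSymbol_eq_div_of_maninDrinfeld`
(`Literature/…/PAdicLFunctionMinusDenominatorsProofs.lean`, this seat). THIS FILE PROVES (a)
(∃ `c ∈ ℚ`) for every pair of normalised rational newforms `f ∈ S₂(Γ₀(N))`, `g ∈ S₂(Γ₀(N'))` with
`aₙ(f) = (n/p)·aₙ(g)` for all `n` and `(−1/p) = −1` (`p ≡ 3 (mod 4)`: ODD character, so the twist
swaps the real and imaginary parts of the modular symbols). The steps are GEN 3's with one sign: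
1. (`modularSymbol_eq_sum_of_cuspCoeff_eq`, GEN 3) `{∞, r}_f = τ⁻¹ ∑_u (u/p) {∞, r + u/p}_g`
   (Shimura 1971 Prop. 3.64 integrated, `q`-expansion uniqueness);
2. (`plusSymbol_eq_sum_minusSymbol_of_cuspCoeff_eq`) at `−r`, reflecting `u ↦ −u` with
   `1`-periodicity and `(−u/p) = −(u/p)`: `{∞, −r}_f = −τ⁻¹ ∑_u (u/p) {∞, −(r + u/p)}_g`, hence
   `plusSymbol f r = τ⁻¹ ∑_u (u/p) · minusSymbol g (r + u/p)` — PLUS of `f` against MINUS of `g`;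
3. (`exists_legendreTwistMinusRel_of_cuspCoeff_eq`) normalise: `plusSymbol f = Ω⁺_f·[·]⁺_f`
   (`plusSymbol_eq_re_holds`, `ratCast_ratPlusSymbol_holds`, `Ω⁺_f > 0`) and
   `minusSymbol g = i·Ω⁻_g·[·]⁻_g` (`ratMinusSymbol_mul_minusPeriod_mul_I`), so
   `[r]⁺_f = c₀·∑_u (u/p)[r + u/p]⁻_g` in `ℂ` with `c₀ = i·Ω⁻_g/(τ(χ̄)Ω⁺_f)` (real: `τ = ±i√p`);
   if some twisted minus sum is non-zero, `c₀` is a quotient of two rationals, otherwise `c = 0`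
   works — descent to `ℚ` WITHOUT any period theorem.
CONSEQUENCE (companion `LegendreTwistMinusRelationOfCurveTwist.lean`): for `E` additive at
`p ≡ 3 (mod 4)` (so at `p = 3`) with newform `f` and `g` the newform of `E♭ = E^{(−p)}`,
`∃ c, LegendreTwistMinusRel p f g c`; whence, by `TameBranchOfSemistableTwistJoin.lean` §6 with
`hden` discharged, the tame branch `IsTameBranchOf f p (ι∘χ_p) α B` EXISTS on (G-ord, `e = 2`) and
(M) at EVERY odd `p` — the premise of `TameBranchRatCharEqAt` is inhabited on the whole defect-2
locus UNCONDITIONALLY. Nothing booked; marks unchanged.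

References: Shimura 1971 Prop. 3.64 [Shimura1971]; Mazur–Tate–Teitelbaum, Invent. Math. 84 (1986)
§I.8 [MazurTateTeitelbaum1986Invent]; Manin 1972 §1.2–1.6, Cor. 3.6 [Manin1972]; Cremona 1997 §2.8
[CremonaAlgorithms1997].
-/

noncomputable section

open scoped Classical MatrixGroups ModularForm Real

open CongruenceSubgroup MeasureTheory Set UpperHalfPlane

namespace Summit.BirchSwinnertonDyer.Rank1Residual.Additive

open Literature.NumberTheory.EllipticCurves Literature.NumberTheory.EllipticCurves.ModularForms
  Literature.NumberTheory.EllipticCurves.Rank1Residual WeierstrassCurve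

/-! ### The plus symbols of a `(·/p)`-twist, `p ≡ 3 (mod 4)`: against the MINUS symbols -/

section Minus

variable {p : ℕ} [hp : Fact p.Prime] {N N' : ℕ} [NeZero N] [NeZero N']

omit [NeZero N] [NeZero N'] in
/-- `(−u/p) = −(u/p)` for the representatives, when `(−1/p) = −1`. [folklore] -/
theorem legendreSym_neg_val_eq_neg (hodd : legendreSym p (-1) = -1) (u : ZMod p) :
    legendreSym p ((-u).val : ℤ) = -legendreSym p (u.val : ℤ) := by
  have h1 : (((-u).val : ℤ) : ZMod p) = (((-1 : ℤ) * (u.val : ℤ) : ℤ) : ZMod p) := by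
    push_cast
    rw [ZMod.natCast_zmod_val, ZMod.natCast_zmod_val, neg_one_mul]
  rw [legendreSym.mod p ((-u).val : ℤ), show (((-u).val : ℤ) : ℤ) % (p : ℤ) =
    ((-1 : ℤ) * (u.val : ℤ)) % (p : ℤ) from (ZMod.intCast_eq_intCast_iff' _ _ _).mp h1,
    ← legendreSym.mod, legendreSym.mul, hodd, neg_one_mul]

/-- **Plus symbols of a `q`-expansion twist, ODD branch** (`(−1/p) = −1`, i.e. `p ≡ 3 (mod 4)`):
`plusSymbol f r = τ⁻¹ ∑_{u mod p} (u/p)·minusSymbol g (r + u/p)` — from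
`modularSymbol_eq_sum_of_cuspCoeff_eq` at `r` and at `−r`, reflecting `u ↦ −u` in the second
(`sum_mul_apply_add_eq_sum_neg`, `1`-periodicity of `{∞, ·}_g`, `(−u/p) = −(u/p)`): the odd
character turns `{∞, r} + {∞, −r}` on the `f`-side into `{∞, ·} − {∞, −·}` on the `g`-side.
[cite: MazurTateTeitelbaum1986Invent, §I.8] [cite: Shimura1971, Prop. 3.64] -/
theorem plusSymbol_eq_sum_minusSymbol_of_cuspCoeff_eq (hp2 : p ≠ 2) (hodd : legendreSym p (-1) = -1)
    {f : CuspForm (Gamma0 N) 2} {g : CuspForm (Gamma0 N') 2}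
    (h : ∀ n, cuspCoeff f n = (legendreSym p n : ℂ) * cuspCoeff g n) (r : ℚ) :
    plusSymbol f r =
      (gaussSum ((quadraticChar (ZMod p)).ringHomComp (Int.castRingHom ℂ))
          (ZMod.stdAddChar (N := p)))⁻¹ *
        ∑ u : ZMod p, (legendreSym p (u.val : ℤ) : ℂ) * minusSymbol g (r + (u.val : ℚ) / p) := by
  have hper : ∀ x : ℚ, modularSymbol g (x + 1) = modularSymbol g x := fun x ↦ by
    exact_mod_cast modularSymbol_add_intCast_holds g x 1
  have h1 := modularSymbol_eq_sum_of_cuspCoeff_eq hp2 h r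
  have h2 := modularSymbol_eq_sum_of_cuspCoeff_eq hp2 h (-r)
  rw [sum_mul_apply_add_eq_sum_neg (fun u : ZMod p ↦ (legendreSym p (u.val : ℤ) : ℂ))
    (modularSymbol g) hper (-r)] at h2
  simp only [legendreSym_neg_val_eq_neg hodd, Int.cast_neg, neg_mul, Finset.sum_neg_distrib] at h2
  have hsum : ∑ u : ZMod p, (legendreSym p (u.val : ℤ) : ℂ) * minusSymbol g (r + (u.val : ℚ) / p) =
      (∑ u : ZMod p, (legendreSym p (u.val : ℤ) : ℂ) * modularSymbol g (r + (u.val : ℚ) / p) -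
        ∑ u : ZMod p, (legendreSym p (u.val : ℤ) : ℂ) * modularSymbol g (-r - (u.val : ℚ) / p)) / 2 := by
    rw [sub_div, Finset.sum_div, Finset.sum_div, ← Finset.sum_sub_distrib]
    refine Finset.sum_congr rfl fun u _ ↦ ?_
    rw [minusSymbol, show -(r + (u.val : ℚ) / p) = -r - (u.val : ℚ) / p by ring]
    ring
  rw [plusSymbol, h1, h2, hsum]
  ring

/-- **The Legendre twist relation on the ODD branch, PROVED.** Let `f ∈ S₂(Γ₀(N))`, `g ∈ S₂(Γ₀(N'))`
be normalised newforms with rational coefficients such that `aₙ(f) = (n/p)·aₙ(g)` for all `n`, `p` an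
odd prime with `(−1/p) = −1`. Then there is `c ∈ ℚ` with `[s]⁺_f = c · ∑_{u mod p} (u/p)·[s + u/p]⁻_g`
for every `s ∈ ℚ` (`LegendreTwistMinusRel p f g c`). Proof: the previous identity in `ℂ` with
`plusSymbol f = Ω⁺_f·[·]⁺_f` (`plusSymbol_eq_re_holds`, `ratCast_ratPlusSymbol_holds`, `Ω⁺_f > 0` by
`IsNewform0.plusPeriod_pos_holds`) and `minusSymbol g = [·]⁻_g·Ω⁻_g·i`
(`ratMinusSymbol_mul_minusPeriod_mul_I`) gives `[s]⁺_f = c₀·∑(u/p)[s + u/p]⁻_g` with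
`c₀ = i·Ω⁻_g/(τ·Ω⁺_f) ∈ ℂ`; if some twisted minus sum is non-zero then `c₀ ∈ ℚ` (a quotient of two
rationals), else `c = 0` works. No period theorem is used.
[cite: Shimura1971, Prop. 3.64] [cite: MazurTateTeitelbaum1986Invent, §I.8] -/
theorem exists_legendreTwistMinusRel_of_cuspCoeff_eq (hp2 : p ≠ 2) (hodd : legendreSym p (-1) = -1)
    {f : CuspForm (Gamma0 N) 2} {g : CuspForm (Gamma0 N') 2} (hf : IsNewform0 f)
    (hfQ : coeffField f = ⊥) (hg : IsNewform0 g) (hgQ : coeffField g = ⊥)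
    (h : ∀ n, cuspCoeff f n = (legendreSym p n : ℂ) * cuspCoeff g n) :
    ∃ c : ℚ, LegendreTwistMinusRel p f g c := by
  -- `plusSymbol f = Ω⁺_f · [·]⁺_f` and `minusSymbol g = [·]⁻_g · Ω⁻_g · i`
  have hrealf : ∀ n, (cuspCoeff f n).im = 0 := cuspCoeff_im_eq_zero_of_coeffField_eq_bot hfQ
  have hΩf : 0 < plusPeriod f := IsNewform0.plusPeriod_pos_holds hf hfQ
  have hPf : ∀ r : ℚ, plusSymbol f r = ((plusPeriod f * (ratPlusSymbol f r : ℝ) : ℝ) : ℂ) := by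
    intro r
    have h1 := plusSymbol_eq_re_holds f hrealf r
    have h2 : (ratPlusSymbol f r : ℝ) = (plusSymbol f r).re / plusPeriod f :=
      ratCast_ratPlusSymbol_holds hf hfQ r
    have h3 : (plusSymbol f r).re = plusPeriod f * (ratPlusSymbol f r : ℝ) := by
      rw [h2]; field_simp
    rw [← h3, h1, Complex.ofReal_re]
  have hMg : ∀ r : ℚ, minusSymbol g r =
      ((ratMinusSymbol g r : ℚ) : ℂ) * ((minusPeriod g : ℝ) : ℂ) * Complex.I := fun r ↦
    (ratMinusSymbol_mul_minusPeriod_mul_I g hg hgQ r).symm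
  -- the identity in `ℂ`: `Ω_f [s]_f = (τ⁻¹ Ω⁻_g i) · Σ (u/p) [s + u/p]⁻_g`
  set K : ℂ := (gaussSum ((quadraticChar (ZMod p)).ringHomComp (Int.castRingHom ℂ))
    (ZMod.stdAddChar (N := p)))⁻¹ * ((minusPeriod g : ℝ) : ℂ) * Complex.I with hK
  set q₂ : ℚ → ℚ := fun s ↦
    ∑ u : ZMod p, (legendreSym p (u.val : ℤ) : ℚ) * ratMinusSymbol g (s + (u.val : ℚ) / p) with hq₂
  have hC : ∀ s : ℚ, ((plusPeriod f : ℝ) : ℂ) * ((ratPlusSymbol f s : ℚ) : ℂ) =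
      K * ((q₂ s : ℚ) : ℂ) := by
    intro s
    have hs := plusSymbol_eq_sum_minusSymbol_of_cuspCoeff_eq hp2 hodd h s
    rw [hPf] at hs
    simp_rw [hMg] at hs
    rw [hq₂, hK]
    push_cast at hs ⊢
    rw [hs, Finset.mul_sum, Finset.mul_sum]
    refine Finset.sum_congr rfl fun u _ ↦ ?_
    ring
  have hΩf0 : ((plusPeriod f : ℝ) : ℂ) ≠ 0 := by exact_mod_cast hΩf.ne'
  by_cases hq : ∃ s₀, q₂ s₀ ≠ 0
  · obtain ⟨s₀, hs₀⟩ := hq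
    refine ⟨ratPlusSymbol f s₀ / q₂ s₀, fun s ↦ ?_⟩
    -- `c₀ = [s₀]_f / q₂ s₀`, then compare at `s`
    have hq0 : ((q₂ s₀ : ℚ) : ℂ) ≠ 0 := by exact_mod_cast hs₀
    have hc0 : K = ((plusPeriod f : ℝ) : ℂ) * ((ratPlusSymbol f s₀ : ℚ) : ℂ) / ((q₂ s₀ : ℚ) : ℂ) := by
      rw [eq_div_iff hq0, hC s₀]
    have hs := hC s
    rw [hc0] at hs
    apply Rat.cast_injective (α := ℂ)
    have : ((ratPlusSymbol f s : ℚ) : ℂ) =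
        ((ratPlusSymbol f s₀ : ℚ) : ℂ) / ((q₂ s₀ : ℚ) : ℂ) * ((q₂ s : ℚ) : ℂ) := by
      field_simp at hs ⊢
      linear_combination hs
    rw [this]
    push_cast [hq₂]
    ring
  · push Not at hq
    refine ⟨0, fun s ↦ ?_⟩
    have hs := hC s
    rw [hq s, Rat.cast_zero, mul_zero] at hs
    have h0 : ((ratPlusSymbol f s : ℚ) : ℂ) = 0 := by
      rcases mul_eq_zero.mp hs with h | h
      · exact absurd h hΩf0
      · exact h
    have h0' : ratPlusSymbol f s = 0 := by exact_mod_cast h0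
    rw [h0', zero_mul]

end Minus

end Summit.BirchSwinnertonDyer.Rank1Residual.Additive

end
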